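import Literature.NumberTheory.EllipticCurves.IwasawaAlgebraMuVanishingProofs
import Literature.NumberTheory.EllipticCurves.IwasawaAlgebraPseudoNullProofs
import Mathlib.NumberTheory.Padics.RingHoms
import HarnessLib

/-!
# `Λ = ℤ_p⟦T⟧`-modules without finite submodules: the characteristic power series ANNIHILATES,
# and `μ = 0` means NO `p`-torsion (proofs only)

Two structural consequences of the structure theorem (proved in the tree:
`Literature.NumberTheory.EllipticCurves.exists_isPseudoIsomorphism_elementary_holds`,
`Literature.NumberTheory.EllipticCurves.charIdeal_eq_span_holds`,
`Literature.NumberTheory.EllipticCurves.muInvariant_eq_zero_iff_finite`,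
`Literature.NumberTheory.EllipticCurves.finite_of_isPseudoNull`) for a finitely generated torsion
`Λ`-module `M` with NO non-trivial finite `Λ`-submodule — the shape in which the Iwasawa modules
of signed Selmer groups arrive (Greenberg, LNM 1716 Prop. 4.14/4.15; B. D. Kim 2013; Kitajima–Otsuki
2018):

* `Literature.NumberTheory.EllipticCurves.IwasawaAlgebra.charElement_smul_elementaryModule` — the
  elementary module `E(μs, fs) = ⨁ Λ/(p^{μᵢ}) ⊕ ⨁ Λ/(fⱼ^{nⱼ})` is killed by its characteristic power
  series `p^{∑ μᵢ} ∏ fⱼ^{nⱼ}`;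
* `Literature.NumberTheory.EllipticCurves.IwasawaAlgebra.smul_eq_zero_of_charIdeal_eq_span_of_noFiniteSubmodule`
  — **`Char(M) = (g)` and no finite submodule ⟹ `g·M = 0`**: a pseudo-isomorphism `M → E` has
  finite (pseudo-null) kernel, which is then trivial, so `M ↪ E` and `E` is killed by a generator of
  `Char(E) = Char(M)`;
* (private helper) a finitely generated `ℤ_p`-module killed by `p` is finite (it is a finitely generated
  `ℤ_p/p = 𝔽_p`-module);
* `Literature.NumberTheory.EllipticCurves.IwasawaAlgebra.eq_zero_of_C_p_smul_eq_zero_of_muInvariant_eq_zero`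
  — **`μ(M) = 0` and no finite submodule ⟹ `M` has no `p`-torsion**: `μ = 0` makes `M` finitely
  generated over `ℤ_p` (Washington §13.2), so `M[p]` is a finitely generated `ℤ_p`-module killed by
  `p`, hence finite, hence `0`.

So for such `M` the alternative «`μ(M) = 0` or `Char(M) = (p)`» becomes «`M` is `ℤ_p`-torsion-free or
`p·M = 0`» (used Summits-side on the Tamagawa rows of the `η`-signed Selmer modules). Proofs only; no
new definition, no named fact.

References: L. C. Washington, *Introduction to Cyclotomic Fields*, §13.2 (Thm. 13.12 and the
definition of `μ`, `λ`, `char`); J. Neukirch, A. Schmidt, K. Wingberg, *Cohomology of Number Fields*,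
Ch. V §3 (5.3.8)–(5.3.10); R. Greenberg, LNM 1716 (1999), Prop. 4.14–4.15 (no finite submodules).
-/

set_option autoImplicit false

noncomputable section

open scoped Classical DirectSum

open Polynomial

namespace Literature.NumberTheory.EllipticCurves.IwasawaAlgebra

variable (p : ℕ) [hp : Fact p.Prime]

/-! ## The elementary module is killed by its characteristic power series -/

/-- The polynomial part `⨁ Λ/(fⱼ^{nⱼ})` of an elementary module is killed by `∏ fⱼ^{nⱼ}` (each
summand by its own factor, which divides the product). [cite: Washington1997, §13.2 (Thm. 13.12)] -/
theorem prod_pow_smul_eq_zero (fs : List (ℤ_[p][X] × ℕ))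
    (y : ⨁ j : Fin fs.length,
      IwasawaAlgebra p ⧸ Ideal.span {((fs.get j).1 : IwasawaAlgebra p) ^ (fs.get j).2}) :
    (fs.map fun f => ((f.1 : IwasawaAlgebra p)) ^ f.2).prod • y = 0 := by
  induction y using DirectSum.induction_on with
  | zero => exact smul_zero _
  | of j y =>
    obtain ⟨y, rfl⟩ := Ideal.Quotient.mk_surjective y
    rw [← DirectSum.of_smul,
      show (fs.map fun f => ((f.1 : IwasawaAlgebra p)) ^ f.2).prod • Ideal.Quotient.mk _ y =
        Ideal.Quotient.mk _ ((fs.map fun f => ((f.1 : IwasawaAlgebra p)) ^ f.2).prod * y) from rfl,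
      Ideal.Quotient.eq_zero_iff_mem.2, map_zero]
    refine Ideal.mul_mem_right _ _ (Ideal.mem_span_singleton.2 ?_)
    exact List.dvd_prod (List.mem_map.2 ⟨fs.get j, List.get_mem fs j, rfl⟩)
  | add x y hx hy => rw [smul_add, hx, hy, add_zero]

/-- **The elementary module `E(μs, fs) = ⨁ Λ/(p^{μᵢ}) ⊕ ⨁ Λ/(fⱼ^{nⱼ})` is killed by its characteristic
power series `p^{∑ μᵢ} · ∏ fⱼ^{nⱼ}`** (`charElement`). [cite: Washington1997, §13.2 (Thm. 13.12)] -/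
theorem charElement_smul_elementaryModule (μs : List ℕ) (fs : List (ℤ_[p][X] × ℕ))
    (y : elementaryModule p μs fs) : charElement p μs fs • y = 0 := by
  have h1 : charElement p μs fs • y.1 = 0 := by
    unfold charElement
    rw [mul_comm, mul_smul, map_pow, C_p_pow_sum_smul_eq_zero, smul_zero]
  have h2 : charElement p μs fs • y.2 = 0 := by
    unfold charElement
    rw [mul_smul, prod_pow_smul_eq_zero, smul_zero]
  exact Prod.ext h1 h2

/-! ## No finite submodule: `Char(M)` annihilates, `μ = 0` means no `p`-torsion -/

section NoFiniteSubmodule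

variable (M : Type*) [AddCommGroup M] [Module (IwasawaAlgebra p) M]

/-- **`Char(M) = (g)` and `M` has no non-trivial finite `Λ`-submodule ⟹ `g • x = 0` for every
`x ∈ M`** (`M` finitely generated torsion). By the structure theorem there is a pseudo-isomorphism
`φ : M → E(μs, fs)`; its kernel is pseudo-null, i.e. finite, hence `⊥` by hypothesis, so `φ` is
injective; `Char(M) = (p^{∑ μᵢ} ∏ fⱼ^{nⱼ})`, so `g` is a unit multiple of the characteristic power
series of `E`, which kills `E`. [cite: Washington1997, §13.2 (Thm. 13.12)]
[cite: NeukirchSchmidtWingberg2008, Ch. V §3 (5.3.8)] -/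
theorem smul_eq_zero_of_charIdeal_eq_span_of_noFiniteSubmodule [Module.Finite (IwasawaAlgebra p) M]
    (hM : Module.IsTorsion (IwasawaAlgebra p) M)
    (hnf : ∀ N : Submodule (IwasawaAlgebra p) M, Finite N → N = ⊥)
    {g : IwasawaAlgebra p} (hg : Module.charIdeal (IwasawaAlgebra p) M = Ideal.span {g}) (x : M) :
    g • x = 0 := by
  obtain ⟨μs, fs, -, hfs, φ, hker, hcoker⟩ := exists_isPseudoIsomorphism_elementary_holds p M hM
  -- the kernel of the pseudo-isomorphism is finite, hence trivial
  have hfin : Finite (LinearMap.ker φ) := finite_of_isPseudoNull p (M := LinearMap.ker φ) hker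
  have hinj : Function.Injective φ := LinearMap.ker_eq_bot.mp (hnf _ hfin)
  -- `Char(M) = (charElement μs fs)`, so `g` and the characteristic power series are associated
  have hchar : Module.charIdeal (IwasawaAlgebra p) M = Ideal.span {charElement p μs fs} :=
    charIdeal_eq_span_holds p M (fun f hf => (hfs f hf).1) ⟨φ, hker, hcoker⟩
  rw [hg] at hchar
  obtain ⟨u, hu⟩ := Ideal.span_singleton_eq_span_singleton.mp hchar
  have hgu : g = (↑u⁻¹ : IwasawaAlgebra p) * charElement p μs fs := by
    rw [← hu, mul_comm g, ← mul_assoc, Units.inv_mul, one_mul]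
  apply hinj
  rw [map_smul, map_zero, hgu, mul_smul, charElement_smul_elementaryModule, smul_zero]

/-- A finitely generated `ℤ_p`-module killed by `p` is FINITE (it is a finitely generated module over
the finite ring `ℤ_p/(p) ≅ 𝔽_p`). [folklore] -/
private theorem finite_of_p_smul_eq_zero {N : Type*} [AddCommGroup N] [Module ℤ_[p] N] [Module.Finite ℤ_[p] N]
    (h : ∀ x : N, (p : ℤ_[p]) • x = 0) : Finite N := by
  set I : Ideal ℤ_[p] := Ideal.span {(p : ℤ_[p])} with hI
  have htors : Module.IsTorsionBySet ℤ_[p] N ↑I := by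
    intro x ⟨a, ha⟩
    obtain ⟨b, rfl⟩ := Ideal.mem_span_singleton'.mp ha
    change (b * (p : ℤ_[p])) • x = 0
    rw [mul_smul, h, smul_zero]
  letI := htors.module
  haveI : IsScalarTower ℤ_[p] (ℤ_[p] ⧸ I) N := htors.isScalarTower
  haveI : Module.Finite (ℤ_[p] ⧸ I) N := Module.Finite.of_restrictScalars_finite ℤ_[p] _ _
  -- `ℤ_p/(p) ≅ 𝔽_p` is finite
  haveI : Finite (ℤ_[p] ⧸ I) := by
    have hk : RingHom.ker (PadicInt.toZMod : ℤ_[p] →+* ZMod p) = I := by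
      rw [PadicInt.ker_toZMod, PadicInt.maximalIdeal_eq_span_p]
    exact Finite.of_equiv (ZMod p)
      ((Ideal.quotEquivOfEq hk.symm).trans
        (RingHom.quotientKerEquivOfSurjective (ZMod.ringHom_surjective PadicInt.toZMod))).symm.toEquiv
  exact Module.finite_of_finite (ℤ_[p] ⧸ I)

/-- **`μ(M) = 0` and `M` has no non-trivial finite `Λ`-submodule ⟹ `M` has no `p`-torsion** (`M`
finitely generated torsion, with any compatible `ℤ_p`-structure): `μ(M) = 0` makes `M` finitely
generated over `ℤ_p` (`muInvariant_eq_zero_iff_finite`, Washington §13.2), so the `Λ`-submodule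
`M[p]` is a finitely generated `ℤ_p`-module killed by `p`, hence finite, hence `⊥`.
[cite: Washington1997, §13.2 (after Thm. 13.12)] [cite: NeukirchSchmidtWingberg2008, Ch. V §3 (5.3.10)] -/
theorem eq_zero_of_C_p_smul_eq_zero_of_muInvariant_eq_zero [Module.Finite (IwasawaAlgebra p) M]
    [Module ℤ_[p] M] [IsScalarTower ℤ_[p] (IwasawaAlgebra p) M]
    (hM : Module.IsTorsion (IwasawaAlgebra p) M)
    (hnf : ∀ N : Submodule (IwasawaAlgebra p) M, Finite N → N = ⊥)
    (hμ : muInvariant p M = 0) {x : M} (hx : (PowerSeries.C (p : ℤ_[p]) : IwasawaAlgebra p) • x = 0) :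
    x = 0 := by
  have hfg : Module.Finite ℤ_[p] M := (muInvariant_eq_zero_iff_finite p M hM).mp hμ
  -- the `Λ`-submodule `M[p]`
  set N : Submodule (IwasawaAlgebra p) M :=
    Submodule.torsionBy (IwasawaAlgebra p) M (PowerSeries.C (p : ℤ_[p])) with hN
  have hxN : x ∈ N := (Submodule.mem_torsionBy_iff _ _).mpr hx
  -- as a `ℤ_p`-module it is finitely generated (ℤ_p Noetherian) and killed by `p`
  haveI : IsNoetherian ℤ_[p] M := isNoetherian_of_isNoetherianRing_of_finite ℤ_[p] M
  haveI : Module.Finite ℤ_[p] (N.restrictScalars ℤ_[p]) := Module.IsNoetherian.finite ℤ_[p] _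
  have hkill : ∀ y : N.restrictScalars ℤ_[p], (p : ℤ_[p]) • y = 0 := by
    rintro ⟨y, hy⟩
    apply Subtype.ext
    change (p : ℤ_[p]) • y = 0
    have hy' : (PowerSeries.C (p : ℤ_[p]) : IwasawaAlgebra p) • y = 0 :=
      (Submodule.mem_torsionBy_iff _ _).mp hy
    rw [← algebraMap_smul (IwasawaAlgebra p) (p : ℤ_[p]) y, ← PowerSeries.C_eq_algebraMap]
    exact hy'
  have hfinN : Finite (N.restrictScalars ℤ_[p]) := finite_of_p_smul_eq_zero p hkill
  have hfinN' : Finite N := Finite.of_equiv _ (Equiv.refl _ : ↥(N.restrictScalars ℤ_[p]) ≃ ↥N)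
  have hbot : N = ⊥ := hnf N hfinN'
  rw [hbot, Submodule.mem_bot] at hxN
  exact hxN

end NoFiniteSubmodule

end Literature.NumberTheory.EllipticCurves.IwasawaAlgebra

end
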